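import Mathlib

/-!
# Crux `MonotoneSuffices` (stmt-PneNP-18026), line `slice-transport` — stub `stub_transport`, part 10:
# the parameters of the transport, asymptotically

With `N = C(n,2)` edge slots, `L = ⌊log₂ n⌋`, the transport slice `m⋆ = ⌊N/2⌋ + Δ`, `Δ = n(L+1)`,
the planted clique size `k = ⌈n^{1/2-δ}⌉` and its slot count `κ = C(min k n, 2)` (`0 < δ < 1/2`):

* `eventually_transport_params` — for all large `n`: `N₀ ≤ N`, `κ ≤ m⋆ ≤ N`, `1 ≤ m⋆`, `0 < Δ`,
  `2Δ ≤ m⋆`, `2N ≤ (Δ+1)²` and `c N⁴ ≤ n⁹` (any fixed `c, N₀`);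
* the three error terms of the averaging argument tend to `0`:
  `κ/√(N-κ+1)` (`tendsto_kappa_div_sqrt`), `2Δκ/m⋆` (`tendsto_delta_kappa_div`),
  `N/(2Δ²)` (`tendsto_choose_div_delta_sq`).
-/

set_option linter.dupNamespace false -- `Summit.PneNP.PneNP.…`: summit = sub-problem name (D-0017 single-conjunct layout)

namespace Summit.PneNP.PneNP.Theorems.MonotoneSuffices.SliceTransport

open Filter Finset Real

/-! ### Elementary facts on `C(n,2)`, `⌊log₂ n⌋`, `⌈n^{1/2-δ}⌉` -/

/-- `2 · C(n,2) = n (n-1)`. [folklore] -/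
theorem two_mul_choose_two' (n : ℕ) : 2 * n.choose 2 = n * (n - 1) := by
  rw [Nat.choose_two_right, mul_comm 2, Nat.div_mul_cancel (Nat.even_mul_pred_self n).two_dvd]

/-- `C(n,2) ≤ n²`. [folklore] -/
theorem choose_two_le_sq (n : ℕ) : n.choose 2 ≤ n ^ 2 := by
  have := two_mul_choose_two' n
  have h : n * (n - 1) ≤ n * n := Nat.mul_le_mul_left n (Nat.sub_le n 1)
  nlinarith

/-- `16 (L + 1) + 3 ≤ 2^L` for `L ≥ 8`. [folklore] -/
theorem sixteen_mul_le_two_pow {L : ℕ} (hL : 8 ≤ L) : 16 * (L + 1) + 3 ≤ 2 ^ L := by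
  induction L, hL using Nat.le_induction with
  | base => norm_num
  | succ L hL ih =>
    calc 16 * (L + 1 + 1) + 3 = (16 * (L + 1) + 3) + 16 := by ring
      _ ≤ 2 ^ L + 2 ^ L := Nat.add_le_add ih (by
          calc 16 = 2 ^ 4 := by norm_num
            _ ≤ 2 ^ L := Nat.pow_le_pow_right (by norm_num) (by omega))
      _ = 2 ^ (L + 1) := by ring

/-- Eventually `16 (⌊log₂ n⌋ + 1) + 3 ≤ n`. [folklore] -/
theorem eventually_sixteen_log_le : ∀ᶠ n : ℕ in atTop, 16 * (Nat.log 2 n + 1) + 3 ≤ n := by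
  filter_upwards [eventually_ge_atTop (2 ^ 8)] with n hn
  have hL : 8 ≤ Nat.log 2 n := Nat.le_log_of_pow_le (by norm_num) hn
  exact (sixteen_mul_le_two_pow hL).trans (Nat.pow_log_le_self 2 (by omega))

/-- The planted clique size: `⌈n^{1/2-δ}⌉ ≤ √n + 1` for `0 < δ`, `n ≥ 1`. [folklore] -/
theorem ceil_rpow_le_sqrt_add_one {δ : ℝ} (hδ : 0 < δ) {n : ℕ} (hn : 1 ≤ n) :
    (⌈(n : ℝ) ^ (1 / 2 - δ)⌉₊ : ℝ) ≤ Real.sqrt n + 1 := by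
  have hn1 : (1 : ℝ) ≤ n := by exact_mod_cast hn
  have h1 : (n : ℝ) ^ (1 / 2 - δ) ≤ (n : ℝ) ^ (1 / 2 : ℝ) :=
    Real.rpow_le_rpow_of_exponent_le hn1 (by linarith)
  rw [← Real.sqrt_eq_rpow] at h1
  have h2 := Nat.ceil_lt_add_one (Real.rpow_nonneg (by linarith : (0 : ℝ) ≤ n) (1 / 2 - δ))
  linarith

/-- `κ = C(min k n, 2) ≤ 4 n` with `k = ⌈n^{1/2-δ}⌉` (`0 < δ`). [folklore] -/
theorem kappa_le_four_mul {δ : ℝ} (hδ : 0 < δ) (n : ℕ) :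
    (min ⌈(n : ℝ) ^ (1 / 2 - δ)⌉₊ n).choose 2 ≤ 4 * n := by
  rcases Nat.eq_zero_or_pos n with rfl | hn
  · simp
  set k := ⌈(n : ℝ) ^ (1 / 2 - δ)⌉₊ with hk
  have h1 : (min k n).choose 2 ≤ (min k n) ^ 2 := Nat.choose_le_pow _ 2
  have h2 : (min k n) ^ 2 ≤ k ^ 2 := Nat.pow_le_pow_left (min_le_left k n) 2
  have h3 : ((k ^ 2 : ℕ) : ℝ) ≤ 4 * n := by
    have hk' := ceil_rpow_le_sqrt_add_one hδ hn
    rw [← hk] at hk'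
    have hs : Real.sqrt n ^ 2 = n := Real.sq_sqrt (Nat.cast_nonneg n)
    have hs1 : 1 ≤ Real.sqrt n := by
      rw [show (1 : ℝ) = Real.sqrt 1 by simp]
      exact Real.sqrt_le_sqrt (by exact_mod_cast hn)
    push_cast
    nlinarith [sq_nonneg (Real.sqrt n - 1), Nat.cast_nonneg (α := ℝ) k]
  have h4 : k ^ 2 ≤ 4 * n := by exact_mod_cast h3
  omega

/-- `κ ≤ 4 n^{1-2δ}` as reals (`0 < δ < 1/2`, `n ≥ 1`). [folklore] -/
theorem kappa_le_four_rpow {δ : ℝ} (hδ' : δ < 1 / 2) {n : ℕ} (hn : 1 ≤ n) :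
    (((min ⌈(n : ℝ) ^ (1 / 2 - δ)⌉₊ n).choose 2 : ℕ) : ℝ) ≤ 4 * (n : ℝ) ^ (1 - 2 * δ) := by
  set k := ⌈(n : ℝ) ^ (1 / 2 - δ)⌉₊ with hk
  have hnpos : (0 : ℝ) < n := by exact_mod_cast hn
  have h1 : (((min k n).choose 2 : ℕ) : ℝ) ≤ ((k ^ 2 : ℕ) : ℝ) := by
    exact_mod_cast (Nat.choose_le_pow _ 2).trans (Nat.pow_le_pow_left (min_le_left k n) 2)
  have hone : (1 : ℝ) ≤ (n : ℝ) ^ (1 / 2 - δ) := Real.one_le_rpow (by exact_mod_cast hn) (by linarith)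
  have hk2 : (k : ℝ) ≤ 2 * (n : ℝ) ^ (1 / 2 - δ) := by
    have := Nat.ceil_lt_add_one (Real.rpow_nonneg hnpos.le (1 / 2 - δ))
    rw [← hk] at this
    linarith
  have hsq : ((n : ℝ) ^ (1 / 2 - δ)) ^ 2 = (n : ℝ) ^ (1 - 2 * δ) := by
    rw [← Real.rpow_mul_natCast hnpos.le]
    norm_num
    ring_nf
  calc (((min k n).choose 2 : ℕ) : ℝ) ≤ ((k ^ 2 : ℕ) : ℝ) := h1
    _ = (k : ℝ) ^ 2 := by push_cast; ring
    _ ≤ (2 * (n : ℝ) ^ (1 / 2 - δ)) ^ 2 := by gcongr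
    _ = 4 * (n : ℝ) ^ (1 - 2 * δ) := by rw [mul_pow, hsq]; norm_num

/-! ### The parameters, eventually -/

/-- **All size conditions of the transport hold for large `n`.** [folklore] -/
theorem eventually_transport_params {δ : ℝ} (hδ : 0 < δ) (c N₀ : ℕ) :
    ∀ᶠ n : ℕ in atTop,
      N₀ ≤ n.choose 2 ∧
      (min ⌈(n : ℝ) ^ (1 / 2 - δ)⌉₊ n).choose 2 ≤ n.choose 2 / 2 + n * (Nat.log 2 n + 1) ∧
      n.choose 2 / 2 + n * (Nat.log 2 n + 1) ≤ n.choose 2 ∧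
      1 ≤ n.choose 2 / 2 + n * (Nat.log 2 n + 1) ∧
      0 < n * (Nat.log 2 n + 1) ∧
      2 * (n * (Nat.log 2 n + 1)) ≤ n.choose 2 / 2 + n * (Nat.log 2 n + 1) ∧
      2 * n.choose 2 ≤ (n * (Nat.log 2 n + 1) + 1) ^ 2 ∧
      c * (n.choose 2) ^ 4 ≤ n ^ 9 := by
  filter_upwards [eventually_sixteen_log_le, eventually_ge_atTop (max (N₀ + 1) (max c 40))] with n hlog hn
  have hN0 : N₀ + 1 ≤ n := le_of_max_le_left hn
  have hc : c ≤ n := le_of_max_le_left (le_of_max_le_right hn)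
  have h40 : 40 ≤ n := le_of_max_le_right (le_of_max_le_right hn)
  set L := Nat.log 2 n with hL
  set N := n.choose 2 with hNdef
  have h2N : 2 * N = n * (n - 1) := two_mul_choose_two' n
  -- `n - 1 ≥ 16 (L+1) + 2`, so `N = n(n-1)/2 ≥ 8 n (L+1) + n`
  have hkey : 8 * (n * (L + 1)) + n ≤ N := by
    have h1 : 16 * (L + 1) + 2 ≤ n - 1 := by omega
    have h2 : 16 * (n * (L + 1)) + 2 * n ≤ n * (n - 1) :=
      calc 16 * (n * (L + 1)) + 2 * n = n * (16 * (L + 1) + 2) := by ring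
        _ ≤ n * (n - 1) := Nat.mul_le_mul_left n h1
    omega
  have hg : n ≤ n * (L + 1) := Nat.le_mul_of_pos_right n (Nat.succ_pos L)
  have hκ := kappa_le_four_mul hδ n
  refine ⟨?_, ?_, ?_, ?_, ?_, ?_, ?_, ?_⟩
  · -- `N₀ ≤ N` since `N ≥ n - 1 ≥ N₀`
    have : n - 1 ≤ N := by
      have h1 : n * (n - 1) ≥ 2 * (n - 1) := Nat.mul_le_mul_right _ (by omega)
      omega
    omega
  · -- `κ ≤ 4 n ≤ N / 2 ≤ m`
    have : 4 * n ≤ N / 2 := by omega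
    omega
  · omega
  · omega
  · positivity
  · omega
  · calc 2 * N = n * (n - 1) := h2N
      _ ≤ n * n := Nat.mul_le_mul_left n (Nat.sub_le n 1)
      _ ≤ (n * (L + 1) + 1) ^ 2 := by nlinarith [Nat.zero_le (n * L)]
  · calc c * N ^ 4 ≤ n * (n ^ 2) ^ 4 := Nat.mul_le_mul hc (Nat.pow_le_pow_left (choose_two_le_sq n) 4)
      _ = n ^ 9 := by ring

/-! ### The three vanishing error terms -/

/-- `n^{-2δ} → 0`. [folklore] -/
theorem tendsto_rpow_neg_two_mul {δ : ℝ} (hδ : 0 < δ) :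
    Tendsto (fun n : ℕ => (n : ℝ) ^ (-(2 * δ))) atTop (nhds 0) :=
  (tendsto_rpow_neg_atTop (by linarith)).comp tendsto_natCast_atTop_atTop

/-- `log n · n^{-2δ} → 0`. [folklore] -/
theorem tendsto_log_mul_rpow_neg {δ : ℝ} (hδ : 0 < δ) :
    Tendsto (fun n : ℕ => Real.log n * (n : ℝ) ^ (-(2 * δ))) atTop (nhds 0) := by
  have h := ((isLittleO_log_rpow_atTop (by linarith : (0 : ℝ) < 2 * δ)).comp_tendsto
    tendsto_natCast_atTop_atTop).tendsto_div_nhds_zero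
  refine h.congr' ?_
  filter_upwards [eventually_ge_atTop 1] with n hn
  have hnpos : (0 : ℝ) < n := by exact_mod_cast hn
  simp only [Function.comp_apply]
  rw [Real.rpow_neg hnpos.le, div_eq_mul_inv]

/-- **`κ / √(N - κ + 1) → 0`.** [folklore] -/
theorem tendsto_kappa_div_sqrt {δ : ℝ} (hδ : 0 < δ) (hδ' : δ < 1 / 2) :
    Tendsto (fun n : ℕ => (((min ⌈(n : ℝ) ^ (1 / 2 - δ)⌉₊ n).choose 2 : ℕ) : ℝ) /
      Real.sqrt (((n.choose 2 - (min ⌈(n : ℝ) ^ (1 / 2 - δ)⌉₊ n).choose 2 : ℕ) : ℝ) + 1)) atTop (nhds 0) := by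
  have hlim : Tendsto (fun n : ℕ => 16 * (n : ℝ) ^ (-(2 * δ))) atTop (nhds 0) := by
    simpa using (tendsto_rpow_neg_two_mul hδ).const_mul 16
  refine squeeze_zero' (Eventually.of_forall fun n => by positivity) ?_ hlim
  filter_upwards [eventually_ge_atTop 40] with n hn
  set κ := (min ⌈(n : ℝ) ^ (1 / 2 - δ)⌉₊ n).choose 2 with hκ
  set N := n.choose 2 with hN
  have hn1 : 1 ≤ n := by omega
  have hnpos : (0 : ℝ) < n := by exact_mod_cast hn1
  have hκ4 : κ ≤ 4 * n := kappa_le_four_mul hδ n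
  have h2N : 2 * N = n * (n - 1) := two_mul_choose_two' n
  -- denominator: `(N - κ) + 1 ≥ n² / 16`, so `√(…) ≥ n / 4`
  have hden : (n : ℝ) ^ 2 / 16 ≤ ((N - κ : ℕ) : ℝ) + 1 := by
    have h1 : n * n ≤ 16 * (N - κ) := by
      have : n * (n - 1) ≥ n * 39 := Nat.mul_le_mul_left n (by omega)
      have hnn : n * (n - 1) + n = n * n := by
        rw [Nat.mul_sub_one, Nat.sub_add_cancel (Nat.le_mul_self n)]
      omega
    have h2 : ((n * n : ℕ) : ℝ) ≤ ((16 * (N - κ) : ℕ) : ℝ) := by exact_mod_cast h1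
    push_cast at h2
    nlinarith
  have hsqrt : (n : ℝ) / 4 ≤ Real.sqrt (((N - κ : ℕ) : ℝ) + 1) :=
    (Real.le_sqrt' (by positivity)).2 (by nlinarith [hden])
  have hκR : (κ : ℝ) ≤ 4 * (n : ℝ) ^ (1 - 2 * δ) := kappa_le_four_rpow hδ' hn1
  have hsplit : (n : ℝ) ^ (1 - 2 * δ) = n * (n : ℝ) ^ (-(2 * δ)) := by
    rw [show (1 - 2 * δ : ℝ) = 1 + -(2 * δ) by ring, Real.rpow_add hnpos, Real.rpow_one]
  calc (κ : ℝ) / Real.sqrt (((N - κ : ℕ) : ℝ) + 1) ≤ (4 * (n : ℝ) ^ (1 - 2 * δ)) / ((n : ℝ) / 4) := by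
        gcongr
      _ = 16 * (n : ℝ) ^ (-(2 * δ)) := by rw [hsplit]; field_simp; norm_num

/-- **`2 Δ κ / m⋆ → 0`.** [folklore] -/
theorem tendsto_delta_kappa_div {δ : ℝ} (hδ : 0 < δ) (hδ' : δ < 1 / 2) :
    Tendsto (fun n : ℕ => 2 * ((n * (Nat.log 2 n + 1) : ℕ) : ℝ) *
      (((min ⌈(n : ℝ) ^ (1 / 2 - δ)⌉₊ n).choose 2 : ℕ) : ℝ) /
        ((n.choose 2 / 2 + n * (Nat.log 2 n + 1) : ℕ) : ℝ)) atTop (nhds 0) := by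
  have hlim : Tendsto (fun n : ℕ => 256 * (Real.log n * (n : ℝ) ^ (-(2 * δ))) + 128 * (n : ℝ) ^ (-(2 * δ)))
      atTop (nhds 0) := by
    simpa using ((tendsto_log_mul_rpow_neg hδ).const_mul 256).add ((tendsto_rpow_neg_two_mul hδ).const_mul 128)
  refine squeeze_zero' (Eventually.of_forall fun n => by positivity) ?_ hlim
  filter_upwards [eventually_ge_atTop 40] with n hn
  set κ := (min ⌈(n : ℝ) ^ (1 / 2 - δ)⌉₊ n).choose 2 with hκ
  set N := n.choose 2 with hN
  set L := Nat.log 2 n with hL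
  have hn1 : 1 ≤ n := by omega
  have hnpos : (0 : ℝ) < n := by exact_mod_cast hn1
  have h2N : 2 * N = n * (n - 1) := two_mul_choose_two' n
  -- `m ≥ N/2 ≥ n²/8`
  have hm : (n : ℝ) ^ 2 / 8 ≤ ((N / 2 + n * (L + 1) : ℕ) : ℝ) := by
    have h1 : n * n ≤ 8 * (N / 2) := by
      have : n * (n - 1) ≥ n * 39 := Nat.mul_le_mul_left n (by omega)
      have hnn : n * (n - 1) + n = n * n := by
        rw [Nat.mul_sub_one, Nat.sub_add_cancel (Nat.le_mul_self n)]
      omega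
    have h2 : ((n * n : ℕ) : ℝ) ≤ ((8 * (N / 2) : ℕ) : ℝ) := by exact_mod_cast h1
    have h3 : (((N / 2 : ℕ)) : ℝ) ≤ ((N / 2 + n * (L + 1) : ℕ) : ℝ) := by exact_mod_cast Nat.le_add_right _ _
    push_cast at h2 h3 ⊢
    nlinarith
  have hmpos : (0 : ℝ) < ((N / 2 + n * (L + 1) : ℕ) : ℝ) := lt_of_lt_of_le (by positivity) hm
  have hκR : (κ : ℝ) ≤ 4 * (n : ℝ) ^ (1 - 2 * δ) := kappa_le_four_rpow hδ' hn1
  -- `L ≤ log₂ n ≤ 2 log n`, so `L + 1 ≤ 2 log n + 1`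
  have hLlog : (L : ℝ) ≤ 2 * Real.log n := by
    have h1 : ((L : ℕ) : ℝ) ≤ Real.logb 2 (n : ℝ) := by
      rw [Real.le_logb_iff_rpow_le (by norm_num) hnpos, Real.rpow_natCast]
      exact_mod_cast Nat.pow_log_le_self 2 (by omega)
    have h2 : Real.logb 2 (n : ℝ) = Real.log n / Real.log 2 := rfl
    have hlog2 : (1 / 2 : ℝ) < Real.log 2 := by
      have := Real.log_two_gt_d9; linarith
    have hlogn : 0 ≤ Real.log n := Real.log_nonneg (by exact_mod_cast hn1)
    rw [h2, le_div_iff₀ (by linarith)] at h1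
    nlinarith [h1, hlog2, Nat.cast_nonneg (α := ℝ) L]
  have hsplit : (n : ℝ) ^ (1 - 2 * δ) = n * (n : ℝ) ^ (-(2 * δ)) := by
    rw [show (1 - 2 * δ : ℝ) = 1 + -(2 * δ) by ring, Real.rpow_add hnpos, Real.rpow_one]
  have hr0 : 0 ≤ (n : ℝ) ^ (-(2 * δ)) := Real.rpow_nonneg hnpos.le _
  have hlogn : 0 ≤ Real.log n := Real.log_nonneg (by exact_mod_cast hn1)
  rw [div_le_iff₀ hmpos]
  have hΔ : ((n * (L + 1) : ℕ) : ℝ) = n * (L + 1) := by push_cast; ring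
  rw [hΔ]
  calc 2 * ((n : ℝ) * (L + 1)) * κ ≤ 2 * ((n : ℝ) * (2 * Real.log n + 1)) * (4 * (n * (n : ℝ) ^ (-(2 * δ)))) := by
        rw [← hsplit]
        gcongr
      _ = (256 * (Real.log n * (n : ℝ) ^ (-(2 * δ))) + 128 * (n : ℝ) ^ (-(2 * δ))) * ((n : ℝ) ^ 2 / 16) := by ring
      _ ≤ (256 * (Real.log n * (n : ℝ) ^ (-(2 * δ))) + 128 * (n : ℝ) ^ (-(2 * δ))) * ((N / 2 + n * (L + 1) : ℕ) : ℝ) := by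
        refine mul_le_mul_of_nonneg_left (le_trans (by nlinarith) hm) (by positivity)

/-- **`N / (2 Δ²) → 0`.** [folklore] -/
theorem tendsto_choose_div_delta_sq :
    Tendsto (fun n : ℕ => ((n.choose 2 : ℕ) : ℝ) / 2 / ((n * (Nat.log 2 n + 1) : ℕ) : ℝ) ^ 2) atTop (nhds 0) := by
  have hlim : Tendsto (fun n : ℕ => (1 : ℝ) / ((Nat.log 2 n : ℕ) + 1 : ℝ)) atTop (nhds 0) := by
    have hlog : Tendsto (fun n : ℕ => Nat.log 2 n) atTop atTop := by
      rw [tendsto_atTop_atTop]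
      intro M
      exact ⟨2 ^ M, fun n hn => Nat.le_log_of_pow_le (by norm_num) hn⟩
    have h1 : Tendsto (fun n : ℕ => ((Nat.log 2 n : ℕ) : ℝ) + 1) atTop atTop :=
      tendsto_atTop_add_const_right _ 1 (tendsto_natCast_atTop_atTop.comp hlog)
    exact tendsto_const_nhds.div_atTop h1
  refine squeeze_zero' (Eventually.of_forall fun n => by positivity) ?_ hlim
  filter_upwards [eventually_ge_atTop 1] with n hn
  set L := Nat.log 2 n with hL
  have hnpos : (0 : ℝ) < n := by exact_mod_cast hn
  have hN : ((n.choose 2 : ℕ) : ℝ) ≤ (n : ℝ) ^ 2 := by exact_mod_cast choose_two_le_sq n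
  have hΔ : ((n * (L + 1) : ℕ) : ℝ) = n * ((L : ℝ) + 1) := by push_cast; ring
  rw [hΔ]
  have hL1 : (1 : ℝ) ≤ (L : ℝ) + 1 := by linarith [Nat.cast_nonneg (α := ℝ) L]
  rw [div_div, div_le_div_iff₀ (by positivity) (by positivity)]
  calc ((n.choose 2 : ℕ) : ℝ) * ((L : ℝ) + 1) ≤ (n : ℝ) ^ 2 * ((L : ℝ) + 1) := by gcongr
    _ ≤ 1 * (2 * ((n : ℝ) * ((L : ℝ) + 1)) ^ 2) := by nlinarith [sq_nonneg ((n : ℝ) * ((L : ℝ) + 1))]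

/-- **transport_params** (registered helper sub-goal of stmt-PneNP-18026 for `stub_transport`,
part 10): all size conditions of the transport hold for large `n` (`eventually_transport_params`).
[folklore] -/
theorem transport_params :
    ∀ {δ : ℝ}, 0 < δ → ∀ c N₀ : ℕ, ∀ᶠ n : ℕ in Filter.atTop, N₀ ≤ n.choose 2 ∧ (min ⌈(n : ℝ) ^ (1 / 2 - δ)⌉₊ n).choose 2 ≤ n.choose 2 / 2 + n * (Nat.log 2 n + 1) ∧ n.choose 2 / 2 + n * (Nat.log 2 n + 1) ≤ n.choose 2 ∧ 1 ≤ n.choose 2 / 2 + n * (Nat.log 2 n + 1) ∧ 0 < n * (Nat.log 2 n + 1) ∧ 2 * (n * (Nat.log 2 n + 1)) ≤ n.choose 2 / 2 + n * (Nat.log 2 n + 1) ∧ 2 * n.choose 2 ≤ (n * (Nat.log 2 n + 1) + 1) ^ 2 ∧ c * (n.choose 2) ^ 4 ≤ n ^ 9 :=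
  fun hδ c N₀ => eventually_transport_params hδ c N₀

end Summit.PneNP.PneNP.Theorems.MonotoneSuffices.SliceTransport
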